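import Summits.QuantumFields.BalabanUV.T4Continuum.Support.TermwiseResidualWitness

/-!
# TermwiseResidualWitnessLedger — leaf S.5 (R-w)(W-w) of road P1 for row NE7, file 2∕2: the END's five residual-witness
# binders `hwpos hRw hRRw∕hrw hWw∕hsw` PRODUCED from a DISPLAYED FORMAT `w = w′ · exp(Σ_{X ∈ wfac K t τ} c(K,t,X))` and
# the eight inputs (W-sc)(W-loc)(W-size)(W-rate-t)(W-mult-F)(W-win)(W-rate-0)(W-mult) of file 1; `Σ_K sw_K < ∞` proved

Cell `pub-balaban`, rung (B)+1 sub-cell t4, lineage `b2b-balaban-t4-ne7-p1` (node U5 = NE7, TERM-WISE member;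
generation 19), skeleton `HOME/t4/b2b-balaban-t4-ne7-p1-g18/SKELETON-NE7-P1.md` v1.6 §2 leaf S.5 + §3 (w9), record
`t4/T4-EST-NE7-P1.md` §25; companion `Support/TermwiseResidualWitness` (the two brackets, one term).  HONEST FRAMING
(page 1): FIXED FINITE T⁴, rung (B)+1 = the `ε → 0` limit of unit-scale averaged expectations, CONDITIONAL on BetaPertH
and the nine spine estimates (0/9 proved); NOT infinite volume, NOT a mass gap, NOT the Clay problem.  NE7 is NOT
PRINTED in [Balaban1984PropagatorsI]–[Balaban1989LargeFieldII] and NOT proved here.  Every estimate below is a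
HYPOTHESIS BINDER named in the statement; the theorems are [folklore] algebra of logarithms, file 1 BY NAME, and
comparison of real series (`T4Crossover.summable_sum_min_pow`, `T4GoodClassBudget.summable_windowSum_log` BY NAME).
No definitions, no cite tags; nothing printed is asserted.  (Universes as in the END: the datum type `ι'`, the
domain type `D` and the background types are `Type`, record §24 (24k) «keep ι' : Type».)

THE FORMAT (W-fmt) — a HYPOTHESIS about NODE O∕F of the skeleton ([dict]): for every cutoff `K`, source `t`, good term `τ`
and admissible datum `v`, run ·'s residual-proper factor is `w· K t τ v = w·′ K t τ v · exp(Σ_{X ∈ wfac K t τ} c·(K,t,X))`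
— field-independent step constants `c·(K,t,X)` (vacuum-energy counterterms and normalisation constants of
[Balaban1988Convergent] (2.23) p. 258 ∕ p. 264, [Balaban1989LargeFieldII] p. 380, under H2's extended format with the
observable) over a ledger `wfac K t τ` of localisation domains, times a residue `w′` that KEEPS binders of the END's own
shape (centre `cW′`, radius `RW′ ≤ vol·rw′_K`, witness constant `c₀′ K`, witness radius `sw′_K`).  Under NODE F's format
decision «every field-dependent factor is booked in the E-, boundary, one-sided, 𝐑- and action kinds» the residue is
`w′ ≡ 1` and its binders are EMPTY (§3); otherwise they are exactly what remains of S.5, displayed.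

WHAT IS PROVED ([folklore]).
§1 **`residualWitness_of_format`** — the END's S.5 binders PRODUCED, indexed by cutoff `K`, source `|t| ≤ l₀`, good term
   `τ ∈ T K ∖ Bad K t`, admissible datum `v ∈ Adm`: `0 < w_A ∧ 0 < w_B`; `|log w_B − log w_A − cW| ≤ RW′` with
   `cW K t τ = cW′ K t τ + Σ_{X ∈ wfac K t τ} (c_B − c_A)(K,t,X)`; `RW′ ≤ vol·rw′_K`; at the witness
   `|log w_B − log w_A − (c₀′ K + Σ_{X ∈ wfac₀ K} (c_B − c_A)(K,0,X))| ≤ vol·(sw′_K + sw_K)` with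
   `sw_K = max(CF,1)·(Ew + CrW)·Σ_{j+n=K} min(aⁿ, θ′^jΛⁿ) + 2·CrW·Cw·windowSum θ′ Λ (jlogOf Cl K) K` — EXACTLY the shapes
   of `hwpos hRw hRRw hWw` in `TermwiseLocal.goodClause_summable_UN_levels_of_thm1At(_coarse)` (TermwiseLocalThm1Ledger.lean
   l.237–244).
§2 **`summable_witnessRadius`** — `Summable (sw′ + sw)` from `Summable sw′`, `0 < a < 1`, `0 < θ′ < 1`, `θ′ ≤ Λ`, `1 ≤ Λ`,
   `0 ≤ Cl`: the `hsw` binder of the END (its `hrw` binder is `w′`'s `Summable rw′`, untouched).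
§3 **`residualWitness_of_fieldIndependent`** — the corollary `w′ ≡ 1`: centre `cW = Σ (c_B − c_A)(K,t,·)`, radius
   `RW = 0`, `rw = 0`, witness constant `c₀ K = Σ_{wfac₀ K} (c_B − c_A)(K,0,·)`, witness radius `sw_K`;
   `summable_witnessRadius_fieldIndependent`.

SO, AFTER THIS FILE: leaf S.5 of road P1 ⇐ (W-fmt) [dict] + (W-loc)(W-win) [data] (I-3) + (W-mult-F)(W-mult) [geom] +
(W-size) one-run HYPOTHESIS SHAPE ((2.48)-type under H2) + (W-rate-t)(W-rate-0) ROW NE5 (named ask, journal l.4888) +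
KERNEL bookkeeping (files 1–2) — nothing else; the OWN-OPEN list of road P1 is {T.2 analytic margin (shared with row
NE9)} modulo t4-ref2's grading of (W-size).  NOT DELIVERED: producers of the (W-·) inputs for Bałaban's objects (NODE
O).  NOT NE7 (spine 0/9 unchanged), NOT summit progress.
-/

noncomputable section

open Finset
open scoped BigOperators

namespace Summit.QuantumFields.BalabanUV.T4Continuum.TermwiseResidualWitness

open Literature.MathematicalPhysics.QuantumFieldTheory.Balaban1983to89
open T4GoodClassBudget T4Crossover T4TermwiseBudget
open T4RecentScale (Multiplicity)

/-! ## §1 The END's five S.5 binders PRODUCED, indexed by cutoff, source, good term and datum -/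

section Indexed

variable {D : Type} {ι' : Type} {σ : Type*} [DecidableEq σ] {BgA BgB : Type} {l₀ vol : ℝ}
  {T : ℕ → Finset σ} {Bad : ℕ → ℝ → Finset σ} {Adm : Set ι'}

/-- **S.5 PRODUCED FROM THE FORMAT.**  For every cutoff `K`, source `|t| ≤ l₀`, good term `τ ∈ T K ∖ Bad K t` and
admissible datum `v ∈ Adm`: IF (W-fmt) the two runs' residual-proper factors are
`w· K t τ v = w·′ K t τ v · exp(Σ_{X ∈ wfac K t τ} c·(K, t, X))` with a residue `w′` obeying the END's own five binder
shapes (centre `cW′`, radius `RW′ ≤ vol·rw′_K`, witness constant `c₀′ K`, witness radius `sw′_K`), and the step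
constants obey (W-sc) scales `≤ K`, (W-loc) no `t`-dependence off the near-support sub-ledger `nf K t τ`, (W-size)
one-run slice sizes `vol·Ew·a^{K−j}` of the `t`-discrepancies, (W-rate-t) two-run rate `CrW·θ′^{scale}·wt` of the
`t`-discrepancies on `nf`, (W-mult-F) near-support multiplicity `CF`, (W-win) the term ledger and the reference ledger
`wfac₀ K` differ only at levels `≥ jlogOf Cl K`, (W-rate-0) two-run rate of the constants at `t = 0`, (W-mult)
multiplicity `Cw` of both ledgers — THEN the END's binders hold VERBATIM: positivity; `|log w_B − log w_A − cW| ≤ RW′` with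
`cW K t τ = cW′ K t τ + Σ_{X ∈ wfac K t τ} (c_B(K,t,X) − c_A(K,t,X))`; `RW′ ≤ vol·rw′_K`; and at the witness
`|log w_B − log w_A − (c₀′ K + Σ_{X ∈ wfac₀ K} (c_B(K,0,X) − c_A(K,0,X)))| ≤ vol·(sw′_K + sw_K)`.  Every input is a
hypothesis; nothing printed is asserted. [folklore] -/
theorem residualWitness_of_format
    (uA : ℕ → ι' → BgA) (uB : ℕ → ι' → BgB) (oneA : BgA) (oneB : BgB)
    (wA wB wA' wB' : ℕ → ℝ → σ → ι' → ℝ) (wfac nf : ℕ → ℝ → σ → Finset D) (wfac₀ : ℕ → Finset D)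
    (cA cB : ℕ → ℝ → D → ℝ) (sc : D → ℕ) (wt : D → ℝ)
    {cW' RW' : ℕ → ℝ → σ → ℝ} {rw' sw' c₀' : ℕ → ℝ} {CF Cw Ew a θ' Λ CrW Cl : ℝ}
    (hvol : 0 ≤ vol) (hEw : 0 ≤ Ew) (ha : 0 ≤ a) (hθ' : 0 ≤ θ') (hΛ : 0 ≤ Λ) (hCrW : 0 ≤ CrW)
    -- (W-fmt) the format of the residual-proper factor, both runs
    (hwA : ∀ K t, |t| ≤ l₀ → ∀ τ ∈ T K \ Bad K t, ∀ v ∈ Adm,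
      wA K t τ v = wA' K t τ v * Real.exp (∑ X ∈ wfac K t τ, cA K t X))
    (hwB : ∀ K t, |t| ≤ l₀ → ∀ τ ∈ T K \ Bad K t, ∀ v ∈ Adm,
      wB K t τ v = wB' K t τ v * Real.exp (∑ X ∈ wfac K t τ, cB K t X))
    -- the residue `w′`'s own binders (EMPTY when `w′ ≡ 1`, §3)
    (hw'pos : ∀ K t, |t| ≤ l₀ → ∀ τ ∈ T K \ Bad K t, ∀ v ∈ Adm, 0 < wA' K t τ v ∧ 0 < wB' K t τ v)
    (hRw' : ∀ K t, |t| ≤ l₀ → ∀ τ ∈ T K \ Bad K t, ∀ v ∈ Adm,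
      |Real.log (wB' K t τ v) - Real.log (wA' K t τ v) - cW' K t τ| ≤ RW' K t τ)
    (hRRw' : ∀ K t, |t| ≤ l₀ → ∀ τ ∈ T K \ Bad K t, RW' K t τ ≤ vol * rw' K)
    (hWw' : ∀ K t, |t| ≤ l₀ → ∀ τ ∈ T K \ Bad K t, ∀ v ∈ Adm, uA K v = oneA → uB K v = oneB →
      |Real.log (wB' K t τ v) - Real.log (wA' K t τ v) - c₀' K| ≤ vol * sw' K)
    -- (W-sc) scales
    (hsc : ∀ K t, |t| ≤ l₀ → ∀ τ ∈ T K \ Bad K t, ∀ X ∈ wfac K t τ, sc X ≤ K) (hsc₀ : ∀ K, ∀ X ∈ wfac₀ K, sc X ≤ K)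
    -- (W-loc) the step constants see `t` only on the near-support sub-ledger
    (hloc : ∀ K t, |t| ≤ l₀ → ∀ τ ∈ T K \ Bad K t, ∀ X ∈ wfac K t τ, X ∉ nf K t τ →
      cA K t X = cA K 0 X ∧ cB K t X = cB K 0 X)
    -- (W-size) one-run slice sizes of the t-discrepancies; (W-rate-t) their two-run rate; (W-mult-F) near-support count
    (hsize : ∀ K t, |t| ≤ l₀ → ∀ τ ∈ T K \ Bad K t, ∀ j ≤ K,
      ∑ X ∈ wfac K t τ with sc X = j, (|cA K t X - cA K 0 X| + |cB K t X - cB K 0 X|) ≤ vol * (Ew * a ^ (K - j)))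
    (hratet : ∀ K t, |t| ≤ l₀ → ∀ τ ∈ T K \ Bad K t, ∀ X ∈ wfac K t τ, X ∈ nf K t τ →
      |(cB K t X - cB K 0 X) - (cA K t X - cA K 0 X)| ≤ CrW * θ' ^ sc X * wt X)
    (hwt : ∀ X, 0 ≤ wt X)
    (hMF : ∀ K t, |t| ≤ l₀ → ∀ τ ∈ T K \ Bad K t, Multiplicity (nf K t τ) sc wt CF vol Λ K)
    -- (W-win) the ledgers differ only on the window; (W-rate-0) two-run rate at `t = 0`; (W-mult) multiplicities
    (hwin : ∀ K t, |t| ≤ l₀ → ∀ τ ∈ T K \ Bad K t, ∀ X ∈ wfac K t τ, X ∉ wfac₀ K → jlogOf Cl K ≤ sc X)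
    (hwin₀ : ∀ K t, |t| ≤ l₀ → ∀ τ ∈ T K \ Bad K t, ∀ X ∈ wfac₀ K, X ∉ wfac K t τ → jlogOf Cl K ≤ sc X)
    (hrate0 : ∀ K t, |t| ≤ l₀ → ∀ τ ∈ T K \ Bad K t, ∀ X ∈ wfac K t τ,
      |cB K 0 X - cA K 0 X| ≤ CrW * θ' ^ sc X * wt X)
    (hrate0' : ∀ K, ∀ X ∈ wfac₀ K, |cB K 0 X - cA K 0 X| ≤ CrW * θ' ^ sc X * wt X)
    (hM : ∀ K t, |t| ≤ l₀ → ∀ τ ∈ T K \ Bad K t, Multiplicity (wfac K t τ) sc wt Cw vol Λ K)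
    (hM₀ : ∀ K, Multiplicity (wfac₀ K) sc wt Cw vol Λ K) :
    (∀ K t, |t| ≤ l₀ → ∀ τ ∈ T K \ Bad K t, ∀ v ∈ Adm, 0 < wA K t τ v ∧ 0 < wB K t τ v) ∧
    (∀ K t, |t| ≤ l₀ → ∀ τ ∈ T K \ Bad K t, ∀ v ∈ Adm,
      |Real.log (wB K t τ v) - Real.log (wA K t τ v)
          - (cW' K t τ + ∑ X ∈ wfac K t τ, (cB K t X - cA K t X))| ≤ RW' K t τ) ∧
    (∀ K t, |t| ≤ l₀ → ∀ τ ∈ T K \ Bad K t, RW' K t τ ≤ vol * rw' K) ∧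
    (∀ K t, |t| ≤ l₀ → ∀ τ ∈ T K \ Bad K t, ∀ v ∈ Adm, uA K v = oneA → uB K v = oneB →
      |Real.log (wB K t τ v) - Real.log (wA K t τ v)
          - (c₀' K + ∑ X ∈ wfac₀ K, (cB K 0 X - cA K 0 X))|
        ≤ vol * (sw' K + (max CF 1 * ((Ew + CrW) * ∑ x ∈ antidiagonal K, min (a ^ x.2) (θ' ^ x.1 * Λ ^ x.2))
            + 2 * (CrW * Cw * windowSum θ' Λ (jlogOf Cl K) K)))) := by
  classical
  -- the log of the format
  have hlog : ∀ K t, |t| ≤ l₀ → ∀ τ ∈ T K \ Bad K t, ∀ v ∈ Adm,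
      Real.log (wB K t τ v) - Real.log (wA K t τ v)
        = (Real.log (wB' K t τ v) - Real.log (wA' K t τ v)) + ∑ X ∈ wfac K t τ, (cB K t X - cA K t X) := by
    intro K t ht τ hτ v hv
    have hp := hw'pos K t ht τ hτ v hv
    rw [hwA K t ht τ hτ v hv, hwB K t ht τ hτ v hv, Real.log_mul hp.2.ne' (Real.exp_pos _).ne',
      Real.log_mul hp.1.ne' (Real.exp_pos _).ne', Real.log_exp, Real.log_exp, sum_sub_distrib]
    ring
  refine ⟨fun K t ht τ hτ v hv => ?_, fun K t ht τ hτ v hv => ?_, hRRw', fun K t ht τ hτ v hv h1A h1B => ?_⟩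
  · have hp := hw'pos K t ht τ hτ v hv
    rw [hwA K t ht τ hτ v hv, hwB K t ht τ hτ v hv]
    exact ⟨mul_pos hp.1 (Real.exp_pos _), mul_pos hp.2 (Real.exp_pos _)⟩
  · rw [hlog K t ht τ hτ v hv]
    have e : Real.log (wB' K t τ v) - Real.log (wA' K t τ v) + ∑ X ∈ wfac K t τ, (cB K t X - cA K t X)
        - (cW' K t τ + ∑ X ∈ wfac K t τ, (cB K t X - cA K t X))
        = Real.log (wB' K t τ v) - Real.log (wA' K t τ v) - cW' K t τ := by ring
    rw [e]
    exact hRw' K t ht τ hτ v hv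
  · rw [hlog K t ht τ hτ v hv]
    have e : Real.log (wB' K t τ v) - Real.log (wA' K t τ v) + ∑ X ∈ wfac K t τ, (cB K t X - cA K t X)
        - (c₀' K + ∑ X ∈ wfac₀ K, (cB K 0 X - cA K 0 X))
        = (Real.log (wB' K t τ v) - Real.log (wA' K t τ v) - c₀' K)
          + ((∑ X ∈ wfac K t τ, (cB K t X - cA K t X)) - ∑ X ∈ wfac₀ K, (cB K 0 X - cA K 0 X)) := by ring
    rw [e, mul_add]
    refine (abs_add_le _ _).trans (add_le_add (hWw' K t ht τ hτ v hv h1A h1B) ?_)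
    exact witness_centring_le (wfac K t τ) (wfac₀ K) (nf K t τ) sc wt (cA K t) (cB K t) (cA K 0) (cB K 0) hvol hEw
      ha hθ' hΛ hCrW (hsc K t ht τ hτ) (hsc₀ K) (hloc K t ht τ hτ) (hsize K t ht τ hτ) (hratet K t ht τ hτ)
      (fun X _ => hwt X) (hMF K t ht τ hτ) (hwin K t ht τ hτ) (hwin₀ K t ht τ hτ)
      (fun X hX => by
        rcases Finset.mem_union.1 hX with h | h
        · exact hrate0 K t ht τ hτ X h
        · exact hrate0' K X h)
      (fun X _ => hwt X) (hM K t ht τ hτ) (hM₀ K)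

end Indexed

/-! ## §2 Summability of the produced witness radius -/

section Summable

/-- **`Σ_K (sw′_K + sw_K) < ∞`** for the witness radius of `residualWitness_of_format`: the residue's `sw′` summable (a
hypothesis; `0` in §3), the t-bracket's crossover summable by `T4Crossover.summable_sum_min_pow` (`0 < a < 1`,
`0 < θ′ < 1`, `θ′ ≤ Λ`), the τ-bracket's window sum by `T4GoodClassBudget.summable_windowSum_log` (`1 ≤ Λ`, `0 ≤ Cl`) —
the `hsw` binder of the END. [folklore] -/
theorem summable_witnessRadius {sw' : ℕ → ℝ} {CF Cw Ew a θ' Λ CrW Cl : ℝ} (hsw' : Summable sw')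
    (ha0 : 0 < a) (ha1 : a < 1) (hθ'0 : 0 < θ') (hθ'1 : θ' < 1) (hθ'Λ : θ' ≤ Λ) (hΛ1 : 1 ≤ Λ) (hCl : 0 ≤ Cl) :
    Summable (fun K => sw' K + (max CF 1 * ((Ew + CrW) * ∑ x ∈ antidiagonal K, min (a ^ x.2) (θ' ^ x.1 * Λ ^ x.2))
        + 2 * (CrW * Cw * windowSum θ' Λ (jlogOf Cl K) K))) := by
  have h1 := (summable_sum_min_pow ha0 ha1 hθ'0 hθ'1 hθ'Λ).mul_left (max CF 1 * (Ew + CrW))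
  have h2 := (summable_windowSum_log hθ'0 hθ'1 hΛ1 hCl).mul_left (2 * (CrW * Cw))
  refine hsw'.add ((h1.add h2).congr fun K => ?_)
  ring

end Summable

/-! ## §3 The field-independent corollary `w′ ≡ 1` (NODE F's format decision: every field-dependent factor is booked in
the E-, boundary, one-sided, 𝐑- and action kinds) -/

section FieldIndependent

variable {D : Type} {ι' : Type} {σ : Type*} [DecidableEq σ] {BgA BgB : Type} {l₀ vol : ℝ}
  {T : ℕ → Finset σ} {Bad : ℕ → ℝ → Finset σ} {Adm : Set ι'}

/-- **S.5 PRODUCED, FIELD-INDEPENDENT RESIDUAL FACTOR.**  If `w· K t τ v = exp(Σ_{X ∈ wfac K t τ} c·(K,t,X))` (no residue),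
then with centre `cW K t τ = Σ_{X∈wfac K t τ}(c_B − c_A)(K,t,X)`, radius `RW = 0`, `rw = 0`, witness constant
`c₀ K = Σ_{X∈wfac₀ K}(c_B − c_A)(K,0,X)` and witness radius `sw_K` (§1's shape) the END's five binders hold — the (R-w)
half TRIVIALLY (the log-ratio IS its centre), the (W-w) half by file 1's `witness_centring_le`. [folklore] -/
theorem residualWitness_of_fieldIndependent
    (uA : ℕ → ι' → BgA) (uB : ℕ → ι' → BgB) (oneA : BgA) (oneB : BgB)
    (wA wB : ℕ → ℝ → σ → ι' → ℝ) (wfac nf : ℕ → ℝ → σ → Finset D) (wfac₀ : ℕ → Finset D)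
    (cA cB : ℕ → ℝ → D → ℝ) (sc : D → ℕ) (wt : D → ℝ) {CF Cw Ew a θ' Λ CrW Cl : ℝ}
    (hvol : 0 ≤ vol) (hEw : 0 ≤ Ew) (ha : 0 ≤ a) (hθ' : 0 ≤ θ') (hΛ : 0 ≤ Λ) (hCrW : 0 ≤ CrW)
    (hwA : ∀ K t, |t| ≤ l₀ → ∀ τ ∈ T K \ Bad K t, ∀ v ∈ Adm, wA K t τ v = Real.exp (∑ X ∈ wfac K t τ, cA K t X))
    (hwB : ∀ K t, |t| ≤ l₀ → ∀ τ ∈ T K \ Bad K t, ∀ v ∈ Adm, wB K t τ v = Real.exp (∑ X ∈ wfac K t τ, cB K t X))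
    (hsc : ∀ K t, |t| ≤ l₀ → ∀ τ ∈ T K \ Bad K t, ∀ X ∈ wfac K t τ, sc X ≤ K) (hsc₀ : ∀ K, ∀ X ∈ wfac₀ K, sc X ≤ K)
    (hloc : ∀ K t, |t| ≤ l₀ → ∀ τ ∈ T K \ Bad K t, ∀ X ∈ wfac K t τ, X ∉ nf K t τ →
      cA K t X = cA K 0 X ∧ cB K t X = cB K 0 X)
    (hsize : ∀ K t, |t| ≤ l₀ → ∀ τ ∈ T K \ Bad K t, ∀ j ≤ K,
      ∑ X ∈ wfac K t τ with sc X = j, (|cA K t X - cA K 0 X| + |cB K t X - cB K 0 X|) ≤ vol * (Ew * a ^ (K - j)))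
    (hratet : ∀ K t, |t| ≤ l₀ → ∀ τ ∈ T K \ Bad K t, ∀ X ∈ wfac K t τ, X ∈ nf K t τ →
      |(cB K t X - cB K 0 X) - (cA K t X - cA K 0 X)| ≤ CrW * θ' ^ sc X * wt X)
    (hwt : ∀ X, 0 ≤ wt X)
    (hMF : ∀ K t, |t| ≤ l₀ → ∀ τ ∈ T K \ Bad K t, Multiplicity (nf K t τ) sc wt CF vol Λ K)
    (hwin : ∀ K t, |t| ≤ l₀ → ∀ τ ∈ T K \ Bad K t, ∀ X ∈ wfac K t τ, X ∉ wfac₀ K → jlogOf Cl K ≤ sc X)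
    (hwin₀ : ∀ K t, |t| ≤ l₀ → ∀ τ ∈ T K \ Bad K t, ∀ X ∈ wfac₀ K, X ∉ wfac K t τ → jlogOf Cl K ≤ sc X)
    (hrate0 : ∀ K t, |t| ≤ l₀ → ∀ τ ∈ T K \ Bad K t, ∀ X ∈ wfac K t τ,
      |cB K 0 X - cA K 0 X| ≤ CrW * θ' ^ sc X * wt X)
    (hrate0' : ∀ K, ∀ X ∈ wfac₀ K, |cB K 0 X - cA K 0 X| ≤ CrW * θ' ^ sc X * wt X)
    (hM : ∀ K t, |t| ≤ l₀ → ∀ τ ∈ T K \ Bad K t, Multiplicity (wfac K t τ) sc wt Cw vol Λ K)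
    (hM₀ : ∀ K, Multiplicity (wfac₀ K) sc wt Cw vol Λ K) :
    (∀ K t, |t| ≤ l₀ → ∀ τ ∈ T K \ Bad K t, ∀ v ∈ Adm, 0 < wA K t τ v ∧ 0 < wB K t τ v) ∧
    (∀ K t, |t| ≤ l₀ → ∀ τ ∈ T K \ Bad K t, ∀ v ∈ Adm,
      |Real.log (wB K t τ v) - Real.log (wA K t τ v) - ∑ X ∈ wfac K t τ, (cB K t X - cA K t X)| ≤ (0 : ℝ)) ∧
    (∀ K t, |t| ≤ l₀ → ∀ τ ∈ T K \ Bad K t, (0 : ℝ) ≤ vol * (0 : ℕ → ℝ) K) ∧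
    (∀ K t, |t| ≤ l₀ → ∀ τ ∈ T K \ Bad K t, ∀ v ∈ Adm, uA K v = oneA → uB K v = oneB →
      |Real.log (wB K t τ v) - Real.log (wA K t τ v) - ∑ X ∈ wfac₀ K, (cB K 0 X - cA K 0 X)|
        ≤ vol * (max CF 1 * ((Ew + CrW) * ∑ x ∈ antidiagonal K, min (a ^ x.2) (θ' ^ x.1 * Λ ^ x.2))
            + 2 * (CrW * Cw * windowSum θ' Λ (jlogOf Cl K) K))) := by
  have h := residualWitness_of_format (l₀ := l₀) (vol := vol) (T := T) (Bad := Bad) (Adm := Adm) uA uB oneA oneB wA wB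
    (fun _ _ _ _ => 1) (fun _ _ _ _ => 1) wfac nf wfac₀ cA cB sc wt (cW' := fun _ _ _ => 0) (RW' := fun _ _ _ => 0)
    (rw' := fun _ => 0) (sw' := fun _ => 0) (c₀' := fun _ => 0) hvol hEw ha hθ' hΛ hCrW
    (fun K t ht τ hτ v hv => by rw [hwA K t ht τ hτ v hv, one_mul])
    (fun K t ht τ hτ v hv => by rw [hwB K t ht τ hτ v hv, one_mul])
    (fun _ _ _ _ _ _ _ => ⟨one_pos, one_pos⟩) (fun _ _ _ _ _ _ _ => by simp) (fun _ _ _ _ _ => by simp)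
    (fun _ _ _ _ _ _ _ _ _ => by simp) hsc hsc₀ hloc hsize hratet hwt hMF hwin hwin₀
    hrate0 hrate0' hM hM₀
  refine ⟨h.1, fun K t ht τ hτ v hv => ?_, fun K t _ τ _ => by simp, fun K t ht τ hτ v hv h1A h1B => ?_⟩
  · simpa using h.2.1 K t ht τ hτ v hv
  · simpa using h.2.2.2 K t ht τ hτ v hv h1A h1B

/-- Its witness radius is summable (§2 with `sw′ = 0`). [folklore] -/
theorem summable_witnessRadius_fieldIndependent {CF Cw Ew a θ' Λ CrW Cl : ℝ}
    (ha0 : 0 < a) (ha1 : a < 1) (hθ'0 : 0 < θ') (hθ'1 : θ' < 1) (hθ'Λ : θ' ≤ Λ) (hΛ1 : 1 ≤ Λ) (hCl : 0 ≤ Cl) :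
    Summable (fun K => max CF 1 * ((Ew + CrW) * ∑ x ∈ antidiagonal K, min (a ^ x.2) (θ' ^ x.1 * Λ ^ x.2))
        + 2 * (CrW * Cw * windowSum θ' Λ (jlogOf Cl K) K)) := by
  simpa using summable_witnessRadius (sw' := fun _ => 0) (CF := CF) (Cw := Cw) (Ew := Ew) (CrW := CrW)
    summable_zero ha0 ha1 hθ'0 hθ'1 hθ'Λ hΛ1 hCl

end FieldIndependent


end Summit.QuantumFields.BalabanUV.T4Continuum.TermwiseResidualWitness
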